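import Summits.QuantumFields.YangMills.Theorems.ColdStartUniversalityLatticeLangevinBakryEmeryCurvature
import Summits.QuantumFields.YangMills.Theorems.ColdStartUniversalityLatticeLangevinFrameEntropicBochner
import HarnessLib

/-!
# Route `ColdStartUniversality` (fixed-cut-off package, Bakry–Émery side, log-Sobolev half): the ENTROPIC CURVATURE
# INEQUALITY `∫ 𝓛(e^h)·𝓛h dμ + ∫ (𝓛e^h)²/e^h dμ ≥ (2 − K₀)·(−∫ 𝓛(e^h)·h dμ)` from a Hessian bound `K₀`

Helper file (seat `ym-line-csu-p1`, g26; `--supports stmt-QuantumFields-24809`).  The log-Sobolev twin of g25's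
`integral_generator_sq_ge_of_hessBound` (`…BakryEmeryCurvature`) for the SU(2) lattice Langevin dynamics of Shen–Zhu–Zhu on `(ℤ/L)³`
at a FIXED cut-off, with the Hessian constant of the plaquette function `ψ̂ = β'Σ_p Re tr U_p` along the noise frame as a parameter
(`hHess`, discharged with `K₀ = 24|β'|` by `wilson_hessBound`):
  ★★ `integral_entropic_curvature_of_hessBound` — for every `C³` function `h` of the real link coordinates, with `𝓛 = 𝓛_(β')` the
  coordinate generator and `μ = μ_(β')` the Wilson measure,
    `(2 − K₀) · (−∫ 𝓛(e^h)·(h∘coords) dμ) ≤ ∫ 𝓛(e^h)·𝓛h dμ + ∫ (𝓛(e^h))² / e^h dμ`.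
Reading: with `f = e^h > 0`, `−∫ 𝓛f · log f = ∫ Γ(f)/f = I(f)` is the Fisher information and the right side is `−(d/dt) I(P_t f)|_(t=0)`
`= 2∫ f Γ₂(log f) dμ`; the inequality is `2∫ f Γ₂(log f) ≥ 2ρ ∫ f Γ(log f)` with `ρ = 1 − K₀/2`, i.e. the ENTROPIC form of the
Bakry–Émery condition `CD(1 − K₀/2, ∞)` — the input of `I' ≤ −2ρ I`, hence of the log-Sobolev inequality `LSI(ρ)` (Bakry–Émery 1985;
Bakry–Gentil–Ledoux 2014 Prop. 5.7.3; Shen–Zhu–Zhu CMP 400 (2023) Thm 4.2 / Cor. 4.4 use exactly this route with `Ric = N/2`).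
Proof: pointwise Bochner (`frameGammaTwo_pointwise`) integrated with the weight `e^h` (`integral_exp_mul_frameGammaTwo_eq`), the Ricci
identity of the noise frame (`exists_noiseFrame` (4): `¼ΣΣ([s_m,s_n]h)² = 2Σ(s_nh)²`), `quarter_sum_sum_sq_bracket_le`, the Hessian bound,
and `generator_eq_half_frameGen` (`𝓛_(β') = ½Σ_n(W_n² + W_nψ̂·W_n)`), `integral_frameDeriv_mul_wilson` (IBP).
THEOREMS ONLY, no definition, no sorry.  HONEST FRAMING: fixed cut-off; conditional on the Hessian bound `K₀`; nothing K-uniform in the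
route's scaling `β'_K → ∞`; no crux, rung or summit statement is proved; the Yang–Mills mass gap is NOT proved.
-/

set_option autoImplicit false

noncomputable section

namespace Summit.QuantumFields.YangMills.Theorems.ColdStartUniversality

open MeasureTheory Matrix Complex Finset
open scoped ComplexConjugate BigOperators Matrix
open Literature.MathematicalPhysics.QuantumFieldTheory
open Literature.MathematicalPhysics.QuantumLattice (fundamentalRep fundamentalLatticeRep continuous_fundamentalRep fundamentalRep_apply)

variable {L : ℕ} [NeZero L]

/-- ★★ **Entropic curvature inequality for the SZZ generator at a fixed cut-off, Hessian constant as a parameter.**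
If the Hessian of the plaquette function along the noise frame is bounded by `K₀` times the carré du champ at every configuration, then
for every `C³` function `h` of the real link coordinates
`(2 − K₀)·(−∫ 𝓛_(β')(e^h)·(h∘coords) dμ_(β')) ≤ ∫ 𝓛_(β')(e^h)·𝓛_(β')h dμ_(β') + ∫ (𝓛_(β')(e^h))²/e^(h∘coords) dμ_(β')`
(`2∫ e^h Γ₂(h) ≥ (2−K₀)∫ e^h Γ(h)`: the Bakry–Émery condition in entropic form).
[cite: ShenZhuZhu2022, §4 Theorem 4.2 and (4.7)–(4.8)] -/
theorem integral_entropic_curvature_of_hessBound (L : ℕ) [NeZero L] (β' K₀ : ℝ)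
    (hHess : (∀ (V : (GaugeConfig 3 L (Matrix.specialUnitaryGroup (Fin 2) ℂ))) (Λ : (Edge 3 L × Fin (fundamentalLatticeRep 2).N × Fin (fundamentalLatticeRep 2).N × Bool → ℝ) →L[ℝ] ℝ),
      ∑ n : Edge 3 L × NoiseIdx (fundamentalLatticeRep 2).N, ∑ m : Edge 3 L × NoiseIdx (fundamentalLatticeRep 2).N,
        Λ ((fun q : Edge 3 L × Fin (fundamentalLatticeRep 2).N × Fin (fundamentalLatticeRep 2).N × Bool => if n.1 = q.1 then (fun z : ℂ => if q.2.2.2 then z.im else z.re) (((Real.sqrt 2 : ℂ) • ((fundamentalLatticeRep 2).lieProj (noiseDir n.2) * (fun (ee : Edge 3 L) => Matrix.of fun (i j : Fin (fundamentalLatticeRep 2).N) => (((fun (V : GaugeConfig 3 L (Matrix.specialUnitaryGroup (Fin 2) ℂ)) (q : Edge 3 L × Fin (fundamentalLatticeRep 2).N × Fin (fundamentalLatticeRep 2).N × Bool) => (fun z : ℂ => if q.2.2.2 then z.im else z.re) ((fundamentalRep (Fin 2) (V q.1) : Matrix (Fin 2) (Fin 2) ℂ) q.2.1 q.2.2.1))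 V (ee, i, j, false) : ℝ) : ℂ) + (((fun (V : GaugeConfig 3 L (Matrix.specialUnitaryGroup (Fin 2) ℂ)) (q : Edge 3 L × Fin (fundamentalLatticeRep 2).N × Fin (fundamentalLatticeRep 2).N × Bool) => (fun z : ℂ => if q.2.2.2 then z.im else z.re) ((fundamentalRep (Fin 2) (V q.1) : Matrix (Fin 2) (Fin 2) ℂ) q.2.1 q.2.2.1)) V (ee, i, j, true) : ℝ) : ℂ) * Complex.I) q.1)) q.2.1 q.2.2.1) else 0)) * Λ ((fun q : Edge 3 L × Fin (fundamentalLatticeRep 2).N × Fin (fundamentalLatticeRep 2).N × Bool => if m.1 = q.1 then (fun z : ℂ => if q.2.2.2 then z.im else z.re) (((Real.sqrt 2 : ℂ) • ((fundamentalLatticeRep 2).lieProj (noiseDir m.2) * (fun (ee : Edge 3 L) => Matrix.of fun (i j : Fin (fundamentalLatticeRep 2).N) => (((fun (V : GaugeConfig 3 L (Matrix.specialUnitaryGroup (Fin 2) ℂ)) (q : Edge 3 L × Fin (fundamentalLatticeRep 2).N × Fin (fundamentalLatticeRep 2).N × Bool) => (fun z : ℂ => if q.2.2.2 then z.im else z.re)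 ((fundamentalRep (Fin 2) (V q.1) : Matrix (Fin 2) (Fin 2) ℂ) q.2.1 q.2.2.1)) V (ee, i, j, false) : ℝ) : ℂ) + (((fun (V : GaugeConfig 3 L (Matrix.specialUnitaryGroup (Fin 2) ℂ)) (q : Edge 3 L × Fin (fundamentalLatticeRep 2).N × Fin (fundamentalLatticeRep 2).N × Bool) => (fun z : ℂ => if q.2.2.2 then z.im else z.re) ((fundamentalRep (Fin 2) (V q.1) : Matrix (Fin 2) (Fin 2) ℂ) q.2.1 q.2.2.1)) V (ee, i, j, true) : ℝ) : ℂ) * Complex.I) q.1)) q.2.1 q.2.2.1) else 0)) *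
          fderiv ℝ (fun z : (Edge 3 L × Fin (fundamentalLatticeRep 2).N × Fin (fundamentalLatticeRep 2).N × Bool → ℝ) => fderiv ℝ (fun y : (Edge 3 L × Fin (fundamentalLatticeRep 2).N × Fin (fundamentalLatticeRep 2).N × Bool → ℝ) => β' * ∑ p : Plaquette 3 L, (rootedLoop (fun (ee : Edge 3 L) (i j : Fin (fundamentalLatticeRep 2).N) => ((y (ee, i, j, false) : ℝ) : ℂ) + ((y (ee, i, j, true) : ℝ) : ℂ) * Complex.I) (p.1, p.2.1.1) p.2.1.2 false).trace.re) z (fun q : Edge 3 L × Fin (fundamentalLatticeRep 2).N × Fin (fundamentalLatticeRep 2).N × Bool => if m.1 = q.1 then (fun z : ℂ => if q.2.2.2 then z.im else z.re) (((Real.sqrt 2 : ℂ) • ((fundamentalLatticeRep 2).lieProj (noiseDir m.2) * (fun (ee : Edge 3 L) => Matrix.of fun (i j : Fin (fundamentalLatticeRep 2).N) => ((z (ee, i, j, false) : ℝ) : ℂ) + ((z (ee, i, j, true) : ℝ) : ℂ) * Complex.I) q.1)) q.2.1 q.2.2.1) else 0)) ((fun (V : GaugeConfig 3 L (Matrix.specialUnitaryGroup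 (Fin 2) ℂ)) (q : Edge 3 L × Fin (fundamentalLatticeRep 2).N × Fin (fundamentalLatticeRep 2).N × Bool) => (fun z : ℂ => if q.2.2.2 then z.im else z.re) ((fundamentalRep (Fin 2) (V q.1) : Matrix (Fin 2) (Fin 2) ℂ) q.2.1 q.2.2.1)) V) (fun q : Edge 3 L × Fin (fundamentalLatticeRep 2).N × Fin (fundamentalLatticeRep 2).N × Bool => if n.1 = q.1 then (fun z : ℂ => if q.2.2.2 then z.im else z.re) (((Real.sqrt 2 : ℂ) • ((fundamentalLatticeRep 2).lieProj (noiseDir n.2) * (fun (ee : Edge 3 L) => Matrix.of fun (i j : Fin (fundamentalLatticeRep 2).N) => (((fun (V : GaugeConfig 3 L (Matrix.specialUnitaryGroup (Fin 2) ℂ)) (q : Edge 3 L × Fin (fundamentalLatticeRep 2).N × Fin (fundamentalLatticeRep 2).N × Bool) => (fun z : ℂ => if q.2.2.2 then z.im else z.re) ((fundamentalRep (Fin 2) (V q.1) : Matrix (Fin 2) (Fin 2) ℂ) q.2.1 q.2.2.1)) V (ee, i, j, false) : ℝ) : ℂ) + (((fun (V : GaugeConfig 3 L (Matrix.specialUnitaryGroup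 (Fin 2) ℂ)) (q : Edge 3 L × Fin (fundamentalLatticeRep 2).N × Fin (fundamentalLatticeRep 2).N × Bool) => (fun z : ℂ => if q.2.2.2 then z.im else z.re) ((fundamentalRep (Fin 2) (V q.1) : Matrix (Fin 2) (Fin 2) ℂ) q.2.1 q.2.2.1)) V (ee, i, j, true) : ℝ) : ℂ) * Complex.I) q.1)) q.2.1 q.2.2.1) else 0)
        ≤ K₀ * ∑ n : Edge 3 L × NoiseIdx (fundamentalLatticeRep 2).N, (Λ (fun q : Edge 3 L × Fin (fundamentalLatticeRep 2).N × Fin (fundamentalLatticeRep 2).N × Bool => if n.1 = q.1 then (fun z : ℂ => if q.2.2.2 then z.im else z.re) (((Real.sqrt 2 : ℂ) • ((fundamentalLatticeRep 2).lieProj (noiseDir n.2) * (fun (ee : Edge 3 L) => Matrix.of fun (i j : Fin (fundamentalLatticeRep 2).N) => (((fun (V : GaugeConfig 3 L (Matrix.specialUnitaryGroup (Fin 2) ℂ)) (q : Edge 3 L × Fin (fundamentalLatticeRep 2).N × Fin (fundamentalLatticeRep 2).N × Bool) => (fun z : ℂ => if q.2.2.2 then z.im else z.re) ((fundamentalRep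 (Fin 2) (V q.1) : Matrix (Fin 2) (Fin 2) ℂ) q.2.1 q.2.2.1)) V (ee, i, j, false) : ℝ) : ℂ) + (((fun (V : GaugeConfig 3 L (Matrix.specialUnitaryGroup (Fin 2) ℂ)) (q : Edge 3 L × Fin (fundamentalLatticeRep 2).N × Fin (fundamentalLatticeRep 2).N × Bool) => (fun z : ℂ => if q.2.2.2 then z.im else z.re) ((fundamentalRep (Fin 2) (V q.1) : Matrix (Fin 2) (Fin 2) ℂ) q.2.1 q.2.2.1)) V (ee, i, j, true) : ℝ) : ℂ) * Complex.I) q.1)) q.2.1 q.2.2.1) else 0)) ^ 2))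
    (h : (Edge 3 L × Fin 2 × Fin 2 × Bool → ℝ) → ℝ) (hh : ContDiff ℝ 3 h) :
    let coords : GaugeConfig 3 L (Matrix.specialUnitaryGroup (Fin 2) ℂ) → (Edge 3 L × Fin 2 × Fin 2 × Bool → ℝ) :=
      fun V q => (fun z : ℂ => if q.2.2.2 then z.im else z.re)
        ((fundamentalRep (Fin 2) (V q.1) : Matrix (Fin 2) (Fin 2) ℂ) q.2.1 q.2.2.1)
    let gen : ((Edge 3 L × Fin 2 × Fin 2 × Bool → ℝ) → ℝ) → GaugeConfig 3 L (Matrix.specialUnitaryGroup (Fin 2) ℂ) → ℝ :=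
      fun h V =>
      (∑ i : Edge 3 L × Fin 2 × Fin 2 × Bool, fderiv ℝ h (coords V) (Pi.single i 1) *
          (fun z : ℂ => if i.2.2.2 then z.im else z.re)
            ((latticeLangevinDynamics (fundamentalLatticeRep 2) β').drift
              (matrixConfig (fundamentalRep (Fin 2)) V) i.1 i.2.1 i.2.2.1) +
      1 / 2 * ∑ i : Edge 3 L × Fin 2 × Fin 2 × Bool, ∑ j : Edge 3 L × Fin 2 × Fin 2 × Bool,
        fderiv ℝ (fun z => fderiv ℝ h z (Pi.single i 1)) (coords V) (Pi.single j 1) *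
          ∑ n : Edge 3 L × NoiseIdx 2,
            (if n.1 = i.1 then (fun z : ℂ => if i.2.2.2 then z.im else z.re)
              ((latticeLangevinDynamics (fundamentalLatticeRep 2) β').noise
                (matrixConfig (fundamentalRep (Fin 2)) V) i.1 n.2 i.2.1 i.2.2.1) else 0) *
            (if n.1 = j.1 then (fun z : ℂ => if j.2.2.2 then z.im else z.re)
              ((latticeLangevinDynamics (fundamentalLatticeRep 2) β').noise
                (matrixConfig (fundamentalRep (Fin 2)) V) j.1 n.2 j.2.1 j.2.2.1) else 0))
    (2 - K₀) * (-∫ V, gen (fun z => Real.exp (h z)) V * h (coords V) ∂(wilsonMeasure (d := 3) (L := L) (fundamentalRep (Fin 2)) β')) ≤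
      ∫ V, gen (fun z => Real.exp (h z)) V * gen h V ∂(wilsonMeasure (d := 3) (L := L) (fundamentalRep (Fin 2)) β') +
        ∫ V, (gen (fun z => Real.exp (h z)) V) ^ 2 / Real.exp (h (coords V)) ∂(wilsonMeasure (d := 3) (L := L) (fundamentalRep (Fin 2)) β') := by
  intro coords gen
  classical
  haveI := secondCountableTopology_su2
  haveI := borelSpace_config L
  set μ : Measure (GaugeConfig 3 L (Matrix.specialUnitaryGroup (Fin 2) ℂ)) := (wilsonMeasure (d := 3) (L := L) (fundamentalRep (Fin 2)) β') with hμ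
  haveI : IsProbabilityMeasure μ :=
    isProbabilityMeasure_wilsonMeasure (d := 3) (L := L) (fundamentalRep (Fin 2)) (continuous_fundamentalRep (Fin 2)) β'
  -- the frame, recast on the tree's flat coordinate space
  obtain ⟨s, c, hs, hbr, hanti, hRic, hCas⟩ := exists_noiseFrame L
  set s2 : (Edge 3 L × NoiseIdx (fundamentalLatticeRep 2).N) → ((Edge 3 L × Fin 2 × Fin 2 × Bool → ℝ) →L[ℝ] (Edge 3 L × Fin 2 × Fin 2 × Bool → ℝ)) := s with hs2def
  have hbr2 : ∀ (n m : Edge 3 L × NoiseIdx (fundamentalLatticeRep 2).N) (y : (Edge 3 L × Fin 2 × Fin 2 × Bool → ℝ)), s2 m (s2 n y) - s2 n (s2 m y) = ∑ k, c n m k • s2 k y :=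
    fun n m y => hbr n m y
  have hRic2 : ∀ (Λ : (Edge 3 L × Fin 2 × Fin 2 × Bool → ℝ) →L[ℝ] ℝ) (y : (Edge 3 L × Fin 2 × Fin 2 × Bool → ℝ)),
      (1 / 4 : ℝ) * ∑ n, ∑ m, (Λ (s2 m (s2 n y) - s2 n (s2 m y))) ^ 2 = 2 * ∑ n, (Λ (s2 n y)) ^ 2 := fun Λ y => hRic Λ y
  set ψ : (Edge 3 L × Fin 2 × Fin 2 × Bool → ℝ) → ℝ := (fun y : (Edge 3 L × Fin 2 × Fin 2 × Bool → ℝ) => β' * ∑ p : Plaquette 3 L, (rootedLoop (fun (ee : Edge 3 L) (i j : Fin 2) => ((y (ee, i, j, false) : ℝ) : ℂ) + ((y (ee, i, j, true) : ℝ) : ℂ) * Complex.I) (p.1, p.2.1.1) p.2.1.2 false).trace.re) with hψ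
  have hψC : ContDiff ℝ 2 ψ := contDiff_psiHat (d := 3) (L := L) (N := 2) (n := 2) β'
  have hψ1 : ContDiff ℝ 1 ψ := hψC.of_le (by norm_num)
  have hh2 : ContDiff ℝ 2 h := hh.of_le (by norm_num)
  have hh1 : ContDiff ℝ 1 h := hh.of_le (by norm_num)
  have hE3 : ContDiff ℝ 3 (fun z : (Edge 3 L × Fin 2 × Fin 2 × Bool → ℝ) => Real.exp (h z)) := Real.contDiff_exp.comp hh
  have hE2 : ContDiff ℝ 2 (fun z : (Edge 3 L × Fin 2 × Fin 2 × Bool → ℝ) => Real.exp (h z)) := hE3.of_le (by norm_num)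
  have hE1 : ContDiff ℝ 1 (fun z : (Edge 3 L × Fin 2 × Fin 2 × Bool → ℝ) => Real.exp (h z)) := hE3.of_le (by norm_num)
  -- integrability of continuous cylinder functions
  have hco : Continuous coords := continuous_coords (L := L)
  have hint : ∀ F : (Edge 3 L × Fin 2 × Fin 2 × Bool → ℝ) → ℝ, Continuous F → Integrable (fun V => F (coords V)) μ := fun F hF =>
    (hF.comp hco).integrable_of_hasCompactSupport (HasCompactSupport.of_compactSpace _)
  -- integration by parts along the frame (Haar invariance)
  have hIBP : ∀ (n : Edge 3 L × NoiseIdx (fundamentalLatticeRep 2).N) (A B : (Edge 3 L × Fin 2 × Fin 2 × Bool → ℝ) → ℝ), ContDiff ℝ 1 A → ContDiff ℝ 1 B →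
      ∫ V, fderiv ℝ A (coords V) (s2 n (coords V)) * B (coords V) ∂μ =
        -∫ V, A (coords V) * fderiv ℝ B (coords V) (s2 n (coords V)) ∂μ -
          ∫ V, A (coords V) * B (coords V) * fderiv ℝ ψ (coords V) (s2 n (coords V)) ∂μ := by
    intro n A B hA hB
    have h := integral_frameDeriv_mul_wilson L β' n (A := A) (B := B) hA hB
    have hsn : ∀ V : (GaugeConfig 3 L (Matrix.specialUnitaryGroup (Fin 2) ℂ)), s2 n (coords V) = (fun q : Edge 3 L × Fin (fundamentalLatticeRep 2).N × Fin (fundamentalLatticeRep 2).N × Bool => if n.1 = q.1 then (fun z : ℂ => if q.2.2.2 then z.im else z.re) (((Real.sqrt 2 : ℂ) • ((fundamentalLatticeRep 2).lieProj (noiseDir n.2) * (fun (ee : Edge 3 L) => Matrix.of fun (i j : Fin (fundamentalLatticeRep 2).N) => (((coords V) (ee, i, j, false) : ℝ) : ℂ) + (((coords V) (ee, i, j, true) : ℝ) : ℂ) * Complex.I) q.1)) q.2.1 q.2.2.1) else 0) := fun V => hs n (coords V)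
    simp_rw [hsn]
    exact h
  -- the entropic Bochner identity and the energy identity for `(e^h, h)`
  have hEnt := integral_exp_mul_frameGammaTwo_eq μ coords s2 ψ c hbr2 hanti hint hIBP hψC hh
  have hEnergy := integral_frameGen_mul_eq_neg_sum μ coords s2 ψ hint hIBP hψ1 hE2 hh1
  -- the generator is half the frame generator
  have hDexp : ∀ V : (GaugeConfig 3 L (Matrix.specialUnitaryGroup (Fin 2) ℂ)), gen (fun z => Real.exp (h z)) V = 1 / 2 * (∑ n, (fderiv ℝ (fun w => fderiv ℝ (fun z => Real.exp (h z)) w (s2 n w)) (coords V) (s2 n (coords V)) + fderiv ℝ ψ (coords V) (s2 n (coords V)) * fderiv ℝ (fun z => Real.exp (h z)) (coords V) (s2 n (coords V)))) :=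
    fun V => generator_eq_half_frameGen L β' s hs hCas (fun z => Real.exp (h z)) hE2 V
  have hDh : ∀ V : (GaugeConfig 3 L (Matrix.specialUnitaryGroup (Fin 2) ℂ)), gen h V = 1 / 2 * (∑ n, (fderiv ℝ (fun w => fderiv ℝ h w (s2 n w)) (coords V) (s2 n (coords V)) + fderiv ℝ ψ (coords V) (s2 n (coords V)) * fderiv ℝ h (coords V) (s2 n (coords V)))) :=
    fun V => generator_eq_half_frameGen L β' s hs hCas h hh2 V
  -- `𝓛(e^h) = e^h (𝓛h + Γh)` and `W_n e^h = e^h W_n h`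
  have hLexp : ∀ y : (Edge 3 L × Fin 2 × Fin 2 × Bool → ℝ), (∑ n, (fderiv ℝ (fun w => fderiv ℝ (fun z => Real.exp (h z)) w (s2 n w)) y (s2 n y) + fderiv ℝ ψ y (s2 n y) * fderiv ℝ (fun z => Real.exp (h z)) y (s2 n y))) = Real.exp (h y) * ((∑ n, (fderiv ℝ (fun w => fderiv ℝ h w (s2 n w)) y (s2 n y) + fderiv ℝ ψ y (s2 n y) * fderiv ℝ h y (s2 n y))) + (∑ n, (fderiv ℝ h y (s2 n y)) ^ 2)) :=
    fun y => frameGen_exp ψ hh2 s2 y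
  have hWexp : ∀ (n : Edge 3 L × NoiseIdx (fundamentalLatticeRep 2).N) (y : (Edge 3 L × Fin 2 × Fin 2 × Bool → ℝ)), fderiv ℝ (fun z => Real.exp (h z)) y (s2 n y) =
      Real.exp (h y) * fderiv ℝ h y (s2 n y) := fun n y => frameDeriv_exp ((hh.differentiable (by norm_num)) y) (s2 n y)
  -- continuity of the frame derivatives
  have cE : Continuous (fun z : (Edge 3 L × Fin 2 × Fin 2 × Bool → ℝ) => Real.exp (h z)) := hE1.continuous
  have cWh : ∀ n, Continuous (fun z => fderiv ℝ h z (s2 n z)) := fun n => (contDiff_frameDeriv (k := 1) hh2 (s2 n)).continuous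
  have cWWh : ∀ n m, Continuous (fun z => fderiv ℝ (fun w => fderiv ℝ h w (s2 n w)) z (s2 m z)) := fun n m =>
    (contDiff_frameDeriv (k := 0) (contDiff_frameDeriv (k := 1) hh2 (s2 n)) (s2 m)).continuous
  have cWWψ : ∀ n m, Continuous (fun z => fderiv ℝ (fun w => fderiv ℝ ψ w (s2 n w)) z (s2 m z)) := fun n m =>
    (contDiff_frameDeriv (k := 0) (contDiff_frameDeriv (k := 1) hψC (s2 n)) (s2 m)).continuous
  have cL : Continuous (fun z : (Edge 3 L × Fin 2 × Fin 2 × Bool → ℝ) => (∑ n, (fderiv ℝ (fun w => fderiv ℝ h w (s2 n w)) z (s2 n z) + fderiv ℝ ψ z (s2 n z) * fderiv ℝ h z (s2 n z)))) := (contDiff_frameGen (k := 0) hh2 hψ1 s2).continuous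
  have cΓ : Continuous (fun z : (Edge 3 L × Fin 2 × Fin 2 × Bool → ℝ) => (∑ n, (fderiv ℝ h z (s2 n z)) ^ 2)) := continuous_finsetSum _ fun n _ => (cWh n).pow 2
  -- pointwise curvature: Ricci part `2Γ`, Hessian part `≥ -K₀Γ`
  have hpt : ∀ V : (GaugeConfig 3 L (Matrix.specialUnitaryGroup (Fin 2) ℂ)), (2 - K₀) * ∑ n, (fderiv ℝ h (coords V) (s2 n (coords V))) ^ 2 ≤
      ∑ n, ∑ m, (fderiv ℝ (fun z => fderiv ℝ h z (s2 n z)) (coords V) (s2 m (coords V))) ^ 2 -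
        ∑ n, ∑ m, fderiv ℝ h (coords V) (s2 n (coords V)) * fderiv ℝ h (coords V) (s2 m (coords V)) *
          fderiv ℝ (fun z => fderiv ℝ ψ z (s2 m z)) (coords V) (s2 n (coords V)) := by
    intro V
    have hq := quarter_sum_sum_sq_bracket_le hh2 s2 (coords V)
    have hr := hRic2 (fderiv ℝ h (coords V)) (coords V)
    have hH : ∑ n, ∑ m, fderiv ℝ h (coords V) (s2 n (coords V)) * fderiv ℝ h (coords V) (s2 m (coords V)) *
        fderiv ℝ (fun z => fderiv ℝ ψ z (s2 m z)) (coords V) (s2 n (coords V)) ≤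
        K₀ * ∑ n, (fderiv ℝ h (coords V) (s2 n (coords V))) ^ 2 := by
      have h0 := hHess V (fderiv ℝ h (coords V))
      have hsV : ∀ k : Edge 3 L × NoiseIdx (fundamentalLatticeRep 2).N, s2 k (coords V) = (fun q : Edge 3 L × Fin (fundamentalLatticeRep 2).N × Fin (fundamentalLatticeRep 2).N × Bool => if k.1 = q.1 then (fun z : ℂ => if q.2.2.2 then z.im else z.re) (((Real.sqrt 2 : ℂ) • ((fundamentalLatticeRep 2).lieProj (noiseDir k.2) * (fun (ee : Edge 3 L) => Matrix.of fun (i j : Fin (fundamentalLatticeRep 2).N) => (((coords V) (ee, i, j, false) : ℝ) : ℂ) + (((coords V) (ee, i, j, true) : ℝ) : ℂ) * Complex.I) q.1)) q.2.1 q.2.2.1) else 0) := fun k => hs k (coords V)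
      have hsz : ∀ k : Edge 3 L × NoiseIdx (fundamentalLatticeRep 2).N, (fun z : (Edge 3 L × Fin 2 × Fin 2 × Bool → ℝ) => fderiv ℝ ψ z (s2 k z)) =
          fun z : (Edge 3 L × Fin 2 × Fin 2 × Bool → ℝ) => fderiv ℝ ψ z (fun q : Edge 3 L × Fin (fundamentalLatticeRep 2).N × Fin (fundamentalLatticeRep 2).N × Bool => if k.1 = q.1 then (fun z : ℂ => if q.2.2.2 then z.im else z.re) (((Real.sqrt 2 : ℂ) • ((fundamentalLatticeRep 2).lieProj (noiseDir k.2) * (fun (ee : Edge 3 L) => Matrix.of fun (i j : Fin (fundamentalLatticeRep 2).N) => ((z (ee, i, j, false) : ℝ) : ℂ) + ((z (ee, i, j, true) : ℝ) : ℂ) * Complex.I) q.1)) q.2.1 q.2.2.1) else 0) := fun k => funext fun z => congrArg (fderiv ℝ ψ z) (hs k z)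
      simp_rw [hsz, hsV]
      exact h0
    have hsymm : ∑ n, ∑ m, (fderiv ℝ (fun z => fderiv ℝ h z (s2 n z)) (coords V) (s2 m (coords V))) ^ 2 =
        ∑ n, ∑ m, (fderiv ℝ (fun z => fderiv ℝ h z (s2 m z)) (coords V) (s2 n (coords V))) ^ 2 := Finset.sum_comm
    rw [hsymm]
    nlinarith [hq, hr, hH]
  -- integrate the pointwise inequality against `e^h dμ`
  have hI1 : ∀ n m, Integrable (fun V => Real.exp (h (coords V)) *
      (fderiv ℝ (fun z => fderiv ℝ h z (s2 n z)) (coords V) (s2 m (coords V))) ^ 2) μ :=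
    fun n m => hint (fun z => Real.exp (h z) * (fderiv ℝ (fun w => fderiv ℝ h w (s2 n w)) z (s2 m z)) ^ 2) (cE.mul ((cWWh n m).pow 2))
  have hI2 : ∀ n m, Integrable (fun V => Real.exp (h (coords V)) * (fderiv ℝ h (coords V) (s2 n (coords V)) *
      fderiv ℝ h (coords V) (s2 m (coords V)) * fderiv ℝ (fun z => fderiv ℝ ψ z (s2 m z)) (coords V) (s2 n (coords V)))) μ :=
    fun n m => hint (fun z => Real.exp (h z) * (fderiv ℝ h z (s2 n z) * fderiv ℝ h z (s2 m z) *
      fderiv ℝ (fun w => fderiv ℝ ψ w (s2 m w)) z (s2 n z))) (cE.mul (((cWh n).mul (cWh m)).mul (cWWψ m n)))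
  have hI3 : ∀ n, Integrable (fun V => Real.exp (h (coords V)) * (fderiv ℝ h (coords V) (s2 n (coords V))) ^ 2) μ := fun n =>
    hint (fun z => Real.exp (h z) * (fderiv ℝ h z (s2 n z)) ^ 2) (cE.mul ((cWh n).pow 2))
  have hcurv : (2 - K₀) * ∑ n, ∫ V, Real.exp (h (coords V)) * (fderiv ℝ h (coords V) (s2 n (coords V))) ^ 2 ∂μ ≤
      (∑ n, ∑ m, ∫ V, Real.exp (h (coords V)) *
          (fderiv ℝ (fun z => fderiv ℝ h z (s2 n z)) (coords V) (s2 m (coords V))) ^ 2 ∂μ) -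
        ∑ n, ∑ m, ∫ V, Real.exp (h (coords V)) * (fderiv ℝ h (coords V) (s2 n (coords V)) *
          fderiv ℝ h (coords V) (s2 m (coords V)) * fderiv ℝ (fun z => fderiv ℝ ψ z (s2 m z)) (coords V) (s2 n (coords V))) ∂μ := by
    have hL : (2 - K₀) * ∑ n, ∫ V, Real.exp (h (coords V)) * (fderiv ℝ h (coords V) (s2 n (coords V))) ^ 2 ∂μ =
        ∫ V, (2 - K₀) * ∑ n, Real.exp (h (coords V)) * (fderiv ℝ h (coords V) (s2 n (coords V))) ^ 2 ∂μ := by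
      rw [← integral_finsetSum _ fun n _ => hI3 n, ← integral_const_mul]
    have hS1 : ∀ n, Integrable (fun V => ∑ m, Real.exp (h (coords V)) *
        (fderiv ℝ (fun z => fderiv ℝ h z (s2 n z)) (coords V) (s2 m (coords V))) ^ 2) μ :=
      fun n => integrable_finsetSum _ fun m _ => hI1 n m
    have hS2 : ∀ n, Integrable (fun V => ∑ m, Real.exp (h (coords V)) * (fderiv ℝ h (coords V) (s2 n (coords V)) *
        fderiv ℝ h (coords V) (s2 m (coords V)) * fderiv ℝ (fun z => fderiv ℝ ψ z (s2 m z)) (coords V) (s2 n (coords V)))) μ :=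
      fun n => integrable_finsetSum _ fun m _ => hI2 n m
    have hA' : (∑ n, ∑ m, ∫ V, Real.exp (h (coords V)) *
          (fderiv ℝ (fun z => fderiv ℝ h z (s2 n z)) (coords V) (s2 m (coords V))) ^ 2 ∂μ) =
        ∫ V, ∑ n, ∑ m, Real.exp (h (coords V)) *
          (fderiv ℝ (fun z => fderiv ℝ h z (s2 n z)) (coords V) (s2 m (coords V))) ^ 2 ∂μ := by
      rw [integral_finsetSum _ fun n _ => hS1 n]
      exact Finset.sum_congr rfl fun n _ => (integral_finsetSum _ fun m _ => hI1 n m).symm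
    have hB' : ∑ n, ∑ m, ∫ V, Real.exp (h (coords V)) * (fderiv ℝ h (coords V) (s2 n (coords V)) *
          fderiv ℝ h (coords V) (s2 m (coords V)) * fderiv ℝ (fun z => fderiv ℝ ψ z (s2 m z)) (coords V) (s2 n (coords V))) ∂μ =
        ∫ V, ∑ n, ∑ m, Real.exp (h (coords V)) * (fderiv ℝ h (coords V) (s2 n (coords V)) *
          fderiv ℝ h (coords V) (s2 m (coords V)) * fderiv ℝ (fun z => fderiv ℝ ψ z (s2 m z)) (coords V) (s2 n (coords V))) ∂μ := by
      rw [integral_finsetSum _ fun n _ => hS2 n]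
      exact Finset.sum_congr rfl fun n _ => (integral_finsetSum _ fun m _ => hI2 n m).symm
    rw [hL, hA', hB', ← integral_sub (integrable_finsetSum _ fun n _ => hS1 n) (integrable_finsetSum _ fun n _ => hS2 n)]
    refine integral_mono ((integrable_finsetSum _ fun n _ => hI3 n).const_mul _)
      ((integrable_finsetSum _ fun n _ => hS1 n).sub (integrable_finsetSum _ fun n _ => hS2 n)) fun V => ?_
    have hV := mul_le_mul_of_nonneg_left (hpt V) (Real.exp_pos (h (coords V))).le
    have e1 : (2 - K₀) * ∑ n, Real.exp (h (coords V)) * (fderiv ℝ h (coords V) (s2 n (coords V))) ^ 2 =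
        Real.exp (h (coords V)) * ((2 - K₀) * ∑ n, (fderiv ℝ h (coords V) (s2 n (coords V))) ^ 2) := by
      rw [Finset.mul_sum, Finset.mul_sum, Finset.mul_sum]
      exact Finset.sum_congr rfl fun n _ => by ring
    have e2 : (∑ n, ∑ m, Real.exp (h (coords V)) *
          (fderiv ℝ (fun z => fderiv ℝ h z (s2 n z)) (coords V) (s2 m (coords V))) ^ 2) -
        ∑ n, ∑ m, Real.exp (h (coords V)) * (fderiv ℝ h (coords V) (s2 n (coords V)) *
          fderiv ℝ h (coords V) (s2 m (coords V)) * fderiv ℝ (fun z => fderiv ℝ ψ z (s2 m z)) (coords V) (s2 n (coords V))) =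
        Real.exp (h (coords V)) * ((∑ n, ∑ m, (fderiv ℝ (fun z => fderiv ℝ h z (s2 n z)) (coords V) (s2 m (coords V))) ^ 2) -
          ∑ n, ∑ m, fderiv ℝ h (coords V) (s2 n (coords V)) * fderiv ℝ h (coords V) (s2 m (coords V)) *
            fderiv ℝ (fun z => fderiv ℝ ψ z (s2 m z)) (coords V) (s2 n (coords V))) := by
      rw [mul_sub, Finset.mul_sum, Finset.mul_sum]
      simp only [Finset.mul_sum]
    beta_reduce
    rw [e1, e2]
    exact hV
  -- the three terms of the goal through the frame
  have iP1 : Integrable (fun V => Real.exp (h (coords V)) * ((∑ n, (fderiv ℝ (fun w => fderiv ℝ h w (s2 n w)) (coords V) (s2 n (coords V)) + fderiv ℝ ψ (coords V) (s2 n (coords V)) * fderiv ℝ h (coords V) (s2 n (coords V)))) + (∑ n, (fderiv ℝ h (coords V) (s2 n (coords V))) ^ 2)) * (∑ n, (fderiv ℝ (fun w => fderiv ℝ h w (s2 n w)) (coords V) (s2 n (coords V)) + fderiv ℝ ψ (coords V) (s2 n (coords V)) * fderiv ℝ h (coords V) (s2 n (coords V))))) μ :=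
    hint (fun z => Real.exp (h z) * ((∑ n, (fderiv ℝ (fun w => fderiv ℝ h w (s2 n w)) z (s2 n z) + fderiv ℝ ψ z (s2 n z) * fderiv ℝ h z (s2 n z))) + (∑ n, (fderiv ℝ h z (s2 n z)) ^ 2)) * (∑ n, (fderiv ℝ (fun w => fderiv ℝ h w (s2 n w)) z (s2 n z) + fderiv ℝ ψ z (s2 n z) * fderiv ℝ h z (s2 n z)))) ((cE.mul (cL.add cΓ)).mul cL)
  have iP2 : Integrable (fun V => Real.exp (h (coords V)) * ((∑ n, (fderiv ℝ (fun w => fderiv ℝ h w (s2 n w)) (coords V) (s2 n (coords V)) + fderiv ℝ ψ (coords V) (s2 n (coords V)) * fderiv ℝ h (coords V) (s2 n (coords V)))) + (∑ n, (fderiv ℝ h (coords V) (s2 n (coords V))) ^ 2)) ^ 2) μ :=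
    hint (fun z => Real.exp (h z) * ((∑ n, (fderiv ℝ (fun w => fderiv ℝ h w (s2 n w)) z (s2 n z) + fderiv ℝ ψ z (s2 n z) * fderiv ℝ h z (s2 n z))) + (∑ n, (fderiv ℝ h z (s2 n z)) ^ 2)) ^ 2) (cE.mul ((cL.add cΓ).pow 2))
  have hLHS : -∫ V, gen (fun z => Real.exp (h z)) V * h (coords V) ∂μ =
      1 / 2 * ∑ n, ∫ V, Real.exp (h (coords V)) * (fderiv ℝ h (coords V) (s2 n (coords V))) ^ 2 ∂μ := by
    have h1 : ∫ V, gen (fun z => Real.exp (h z)) V * h (coords V) ∂μ = 1 / 2 * ∫ V, (∑ n, (fderiv ℝ (fun w => fderiv ℝ (fun z => Real.exp (h z)) w (s2 n w)) (coords V) (s2 n (coords V)) + fderiv ℝ ψ (coords V) (s2 n (coords V)) * fderiv ℝ (fun z => Real.exp (h z)) (coords V) (s2 n (coords V)))) * h (coords V) ∂μ := by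
      rw [← integral_const_mul]
      refine integral_congr_ae (Filter.Eventually.of_forall fun V => ?_)
      simp only [hDexp V]
      ring
    rw [h1, hEnergy]
    have h2 : ∀ n, ∫ V, fderiv ℝ (fun z => Real.exp (h z)) (coords V) (s2 n (coords V)) * fderiv ℝ h (coords V) (s2 n (coords V)) ∂μ =
        ∫ V, Real.exp (h (coords V)) * (fderiv ℝ h (coords V) (s2 n (coords V))) ^ 2 ∂μ :=
      fun n => integral_congr_ae (Filter.Eventually.of_forall fun V => by beta_reduce; rw [hWexp n (coords V)]; ring)
    simp_rw [h2]
    ring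
  have hR1 : ∫ V, gen (fun z => Real.exp (h z)) V * gen h V ∂μ =
      1 / 4 * ∫ V, Real.exp (h (coords V)) * ((∑ n, (fderiv ℝ (fun w => fderiv ℝ h w (s2 n w)) (coords V) (s2 n (coords V)) + fderiv ℝ ψ (coords V) (s2 n (coords V)) * fderiv ℝ h (coords V) (s2 n (coords V)))) + (∑ n, (fderiv ℝ h (coords V) (s2 n (coords V))) ^ 2)) * (∑ n, (fderiv ℝ (fun w => fderiv ℝ h w (s2 n w)) (coords V) (s2 n (coords V)) + fderiv ℝ ψ (coords V) (s2 n (coords V)) * fderiv ℝ h (coords V) (s2 n (coords V)))) ∂μ := by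
    rw [← integral_const_mul]
    refine integral_congr_ae (Filter.Eventually.of_forall fun V => ?_)
    simp only [hDexp V, hDh V]
    rw [hLexp (coords V)]
    ring
  have hR2 : ∫ V, (gen (fun z => Real.exp (h z)) V) ^ 2 / Real.exp (h (coords V)) ∂μ =
      1 / 4 * ∫ V, Real.exp (h (coords V)) * ((∑ n, (fderiv ℝ (fun w => fderiv ℝ h w (s2 n w)) (coords V) (s2 n (coords V)) + fderiv ℝ ψ (coords V) (s2 n (coords V)) * fderiv ℝ h (coords V) (s2 n (coords V)))) + (∑ n, (fderiv ℝ h (coords V) (s2 n (coords V))) ^ 2)) ^ 2 ∂μ := by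
    rw [← integral_const_mul]
    refine integral_congr_ae (Filter.Eventually.of_forall fun V => ?_)
    simp only [hDexp V]
    rw [hLexp (coords V)]
    have hpos : Real.exp (h (coords V)) ≠ 0 := (Real.exp_pos _).ne'
    field_simp
    ring
  have hsum : ∫ V, gen (fun z => Real.exp (h z)) V * gen h V ∂μ +
      ∫ V, (gen (fun z => Real.exp (h z)) V) ^ 2 / Real.exp (h (coords V)) ∂μ =
      1 / 4 * (2 * (∑ n, ∑ m, ∫ V, Real.exp (h (coords V)) *
          (fderiv ℝ (fun z => fderiv ℝ h z (s2 n z)) (coords V) (s2 m (coords V))) ^ 2 ∂μ) -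
        2 * (∑ n, ∑ m, ∫ V, Real.exp (h (coords V)) * (fderiv ℝ h (coords V) (s2 n (coords V)) *
          fderiv ℝ h (coords V) (s2 m (coords V)) * fderiv ℝ (fun z => fderiv ℝ ψ z (s2 m z)) (coords V) (s2 n (coords V))) ∂μ)) := by
    rw [hR1, hR2, ← mul_add, ← integral_add iP1 iP2, ← hEnt]
    congr 1
    refine integral_congr_ae (Filter.Eventually.of_forall fun V => ?_)
    ring
  rw [hLHS, hsum]
  linarith [hcurv]

end Summit.QuantumFields.YangMills.Theorems.ColdStartUniversality
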